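import Summits.QuantumFields.BalabanUV.Beta.GAN24.WoodburyFibre
import Summits.QuantumFields.BalabanUV.Beta.GAN24.MultiplierDictionary
import Summits.QuantumFields.BalabanUV.Beta.GAN24.ConvCBridge

/-!
# GAN24 / WoodburyFibreAssembly — the (CONV-C) resolvent target ASSEMBLED: the multiplier dictionary DISCHARGED by name,
# the multiplier block UNCONDITIONAL, the mixed blocks ANTISYMMETRIC (`MF = −FMᵀ`), and the K-slot EQUIVALENT to the
# field-block residual (`ConvCKWall 3 Lc ↔ ∃ FieldBlocksRate`)

Cell `pub-balaban`, β sub-cell, BINDER ROW **G-an2-4 ∕ (CONV-C)** — NOT IN PRINT; prover part **P3 = WOODBURY-FIBRE reduction**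
(unit `b2b-balaban-gan24-p3`, gen 3).  HONEST FRAMING (verbatim): discharging `BetaPertH` makes Bałaban's UV stability
UNCONDITIONAL — a real constructive-QFT result; it is NOT the continuum limit and NOT the Clay problem.  HONEST DEPENDENCY: continuum
YM on T⁴ ⇐ BetaPertH ∧ nine spine estimates (0/9 proved); BetaPertH ⇐ (D1) ∧ (D4) ∧ CAP+tail; G-an2-4 gates asym, D1 and NE2/3/4.
LABEL: (CONV-C) is not in print; this is our proof attempt.  ABSOLUTE RULE honoured: nothing printed is a hypothesis; no `def … : Prop`
is introduced here; every statement is [folklore] bookkeeping over LANDED theorems BY NAME: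
gan24-formalise-leaf-18's `GAN24/MultiplierDictionary.hdict_three` (p202250; the an2 ↔ b05 junction `TorusJunction` + gan24-p2's
de-periodisation socket inside), this lineage's `GAN24/WoodburyFibre` (p201418) and `GAN24/WoodburyFibreBlocks` (p201215), an5's
`ResolventComposition.KInvStep_inl_inr` ∕ `KInvStep_inr_inl` (`ℋ♭ = −ℋᵀ`), gan24-p1's `GAN24/CombesThomas` ∕ `GAN24/ConvCBridge`.

## What is here (census `HOME/b2b-balaban-gan24-p3/WOODBURY-FIBRE.md` v3, rows (d)(e) and item `MultDict`)

* §1 **`multDict_holds : MultDict Lc (2·Lc⁻⁸)`** — the multiplier dictionary of `GAN24/WoodburyFibre` §3 IS leaf-18's theorem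
  `hdict_three`, pointwise (one line).  Hence **`decays_blockMM`**, **`decays_blockMM_sub`**: BOTH rows of `ConvCResolvent` for the
  multiplier block of `K_j^{(1)} = D_j·KInvStep Lc j·D_j`, UNCONDITIONALLY, with Bałaban's (1.66) constants (`c166Z 3`, `theta166Z 3`,
  `kappaZ 3/(4Lc)`, rate `θ = Lc⁻²`) — the Woodbury-fibre reduction of the census COMPLETED for the `(inr,inr)` block with no hypothesis left.
* §2 **`unitResolvent_inr_inl_eq_neg`**: `K_j^{(1)}(x,y)_{inr μ, inl l} = −K_j^{(1)}(y,x)_{inl l, inr μ}` (an5's `ℋ♭ = −ℋᵀ` read through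
  the decimation and the units); hence `Decays` of the `MF` block (and of its one-step differences) follows from the `FM` block
  (`decays_blockMF_of_blockFM`, `decays_blockMF_sub_of_blockFM`): of the three field blocks only `FF` and `FM` carry work.
* §3 **`fieldBlocksRate_of_FF_FM`**: the residual `FieldBlocksRate` from the `FF` and `FM` rows alone.
* §4 **`convCResolvent_of_fieldBlocksRate`**: `FieldBlocksRate Lc C δK cK θ` (`Lc ≥ 2`, `Lc⁻² ≤ θ`, `δK ≤ kappaZ 3/(4Lc)`) ⟹
  `ConvCResolvent Lc (C + |2Lc⁻⁸|·c166Z 3) δK (cK + cMM Lc (2Lc⁻⁸)) θ` — the row's resolvent target from EXACTLY ONE located residual;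
  `convCResolvent_of_FF_FM` (the same from the two working blocks).
* §5 the converse and the equivalence: `fieldBlocksRate_of_convCResolvent` (blocks of a decaying kernel decay), and
  **`convCKWall_iff_exists_fieldBlocksRate`** (`Lc ≥ 2`): gan24-p1's wall package `ConvCKWall 3 Lc` (≡ `ConvCK 3 Lc`, the binder K-slot
  BY TYPE, TRIGGER-P1) holds IFF the field-block residual holds for SOME admissible constants.  READING: after §1 the K-slot of row
  G-an2-4 IS the field-block estimate and nothing else; the multiplier legs are free.  `unitResolvent_eq_KStepUnit` records that p3's
  object is p1's `KStepUnit Lc j` (rfl), so road P1's leaves feed these sockets by name.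
0 sorry.  NOT the field-block estimate itself (road P1 rows L09–L11), NOT `ConvCKWall`, 0 wall binders instantiated, NOT BetaPertH,
NOT continuum, NOT Clay.
-/

noncomputable section

open Finset
open scoped BigOperators
open Literature.Probability.LatticeModels (Torus.proj)
open Literature.MathematicalPhysics.QuantumFieldTheory.Balaban1983to89
open Literature.MathematicalPhysics.QuantumFieldTheory.Balaban1983to89.Beta
open ExpKernelCalculus (MKer Decays)
open OneStepResolventKernel (Fib KInv eq_zsmul_quo_of_proj KInv_inl_inr_off)
open Literature.MathematicalPhysics.QuantumFieldTheory.LatticeForm (quo)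
open OneStepKernelFamily (KInvStep dec legSet legPt legW LegIdx proj_pow_smul_eq_zero_iff KInvStep_inr_off)
open StepDriftWitness (dec_inl_inr)
open ResolventComposition (KInvStep_inl_inr KInvStep_inr_inl)
open B12Sec2to5 (l1 l1_nonneg)
open Summit.QuantumFields.BalabanUV.Beta.HessKerDressedUnits (unitK unitK_apply legScale legScale_inl legScale_inr)
open Summit.QuantumFields.BalabanUV.Beta.PropagatorWoodburyFibreTarget (sfStep smStep unitResolvent ConvCResolvent)
open Summit.QuantumFields.BalabanUV.Beta.GAN24.DirichletExhaustionDeltaZ (c166Z theta166Z kappaZ kappaZ_pos)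
open Summit.QuantumFields.BalabanUV.Beta.GAN24.WoodburyFibreBlocks
open Summit.QuantumFields.BalabanUV.Beta.GAN24.WoodburyFibre
open Summit.QuantumFields.BalabanUV.Beta.GAN24.TransverseDictionary (theta_lt_one)
open Summit.QuantumFields.BalabanUV.Beta.GAN24.MultiplierDictionary (hdict_three)
open Summit.QuantumFields.BalabanUV.Beta.GAN24.CombesThomas (ConvCK ConvCKWall KStepUnit convCK_of_convCKWall)
open Summit.QuantumFields.BalabanUV.Beta.GAN24.ConvCBridge (convCResolvent_iff convCKWall_of_convCResolvent)

namespace Summit.QuantumFields.BalabanUV.Beta.GAN24.WoodburyFibreAssembly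

variable {Lc : ℕ} [NeZero Lc]

/-! ## §1 The multiplier dictionary DISCHARGED; the multiplier block of (CONV-C) unconditional -/

section Multiplier

variable (Lc) in
/-- **`MultDict` HOLDS with `c = 2·Lc⁻⁸`**: the binder shape of `GAN24/WoodburyFibre` §3 is, pointwise, leaf-18's theorem
`MultiplierDictionary.hdict_three` (the an2 ↔ b05 junction + gan24-p2's de-periodisation; (1.65) of the typed system = (1.66)). [folklore] -/
theorem multDict_holds : MultDict Lc (2 * ((Lc : ℝ) ^ 8)⁻¹) := fun j κ l z => hdict_three Lc j κ l z

/-- **THE MULTIPLIER BLOCK OF (CONV-C), UNIFORM ROW — UNCONDITIONAL**: `|blockMM K_j^{(1)}(x,y)| ≤ |2Lc⁻⁸|·c166Z(3)·e^{−(kappaZ 3/(4Lc))|x−y|₁}`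
for every `j` (`decays_blockMM_of_multDict` at `multDict_holds`). [folklore] -/
theorem decays_blockMM (j : ℕ) :
    Decays (blockMM (unitResolvent Lc j)) (|2 * ((Lc : ℝ) ^ 8)⁻¹| * c166Z 3) (kappaZ 3 / (4 * Lc)) :=
  decays_blockMM_of_multDict (multDict_holds Lc) j

/-- **THE MULTIPLIER BLOCK OF (CONV-C), ALL-SCALES ROW — UNCONDITIONAL** (`Lc ≥ 2`): `|blockMM(K_{k+j}^{(1)} − K_k^{(1)})(x,y)| ≤
cMM Lc (2Lc⁻⁸)·(Lc⁻²)^k·e^{−(kappaZ 3/(4Lc))|x−y|₁}` (`decays_blockMM_sub_of_multDict` at `multDict_holds`). [folklore] -/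
theorem decays_blockMM_sub (hLc : 2 ≤ Lc) (k j : ℕ) :
    Decays (blockMM (unitResolvent Lc (k + j)) - blockMM (unitResolvent Lc k))
      (cMM Lc (2 * ((Lc : ℝ) ^ 8)⁻¹) * (((Lc : ℝ) ^ 2)⁻¹) ^ k) (kappaZ 3 / (4 * Lc)) :=
  decays_blockMM_sub_of_multDict hLc (multDict_holds Lc) k j

/-- p3's object IS p1's: `unitResolvent Lc j = KStepUnit Lc j` (same units, `ConvCBridge.sfStep_eq/smStep_eq`). [folklore] -/
theorem unitResolvent_eq_KStepUnit (j : ℕ) : unitResolvent Lc j = KStepUnit (d := 3) Lc j := rfl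

end Multiplier

/-! ## §2 The mixed blocks are antisymmetric: `MF = −FMᵀ` -/

section Mixed

/-- The `(inl, inr)` entries of `KInvStep Lc j` vanish when the RIGHT (multiplier) leg is off the `Lc`-coarse points. [folklore] -/
theorem KInvStep_inl_inr_off_right {d : ℕ} (j : ℕ) (x : Fin (d + 1) → ℤ) {y : Fin (d + 1) → ℤ} (hy : Torus.proj Lc y ≠ 0)
    (κ l : Fin (d + 1)) : KInvStep (d := d) Lc j x y (Sum.inl κ) (Sum.inr l) = 0 := by
  unfold KInvStep
  rw [dec_inl_inr]
  have hy' : Torus.proj (Lc ^ (j + 1)) (((Lc ^ j : ℕ) : ℤ) • y) ≠ 0 := by rwa [Ne, proj_pow_smul_eq_zero_iff]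
  simp only [KInv_inl_inr_off hy', Finset.sum_const_zero, mul_zero]

/-- **`ℋ♭ = −ℋᵀ` FOR THE ONE-STEP-NORMALISED RESOLVENT**: `K_j^{(1)}(x,y)_{inr μ, inl l} = −K_j^{(1)}(y,x)_{inl l, inr μ}` — an5's
`ResolventComposition.KInvStep_inr_inl` ∕ `KInvStep_inl_inr` (both equal `∓(Lc^j)^{−(d+2)}·𝒬_{Lc^j}ℋ^{(Lc^{j+1})}`) at the coarse
points, both sides `0` off them; the units `s_f·s_m` are symmetric. [folklore] -/
theorem unitResolvent_inr_inl_eq_neg (j : ℕ) (x y : Fin (3 + 1) → ℤ) (μ l : Fin (3 + 1)) :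
    unitResolvent Lc j x y (Sum.inr μ) (Sum.inl l) = -unitResolvent Lc j y x (Sum.inl l) (Sum.inr μ) := by
  unfold unitResolvent
  rw [unitK_apply, unitK_apply]
  simp only [legScale_inl, legScale_inr]
  by_cases hx : Torus.proj Lc x = 0
  · have hxu := eq_zsmul_quo_of_proj (N := Lc) hx
    set z := quo Lc x
    rw [hxu, KInvStep_inr_inl Lc j μ l z y, KInvStep_inl_inr Lc j l μ y z]
    ring
  · rw [KInvStep_inr_off j hx, KInvStep_inl_inr_off_right j y hx]
    ring

omit [NeZero Lc] in
/-- `|x − y|₁ = |y − x|₁`. [folklore] -/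
theorem l1_sub_comm (x y : Fin (3 + 1) → ℤ) : l1 (x - y) = l1 (y - x) := by
  simp only [l1, Pi.sub_apply, Int.cast_sub, abs_sub_comm]

/-- **THE `MF` BLOCK DECAYS IF THE `FM` BLOCK DOES** (same constants). [folklore] -/
theorem decays_blockMF_of_blockFM {j : ℕ} {C δ : ℝ} (h : Decays (blockFM (unitResolvent Lc j)) C δ) :
    Decays (blockMF (unitResolvent Lc j)) C δ := by
  have hC : 0 ≤ C := h.nonneg (Sum.inl 0)
  intro x y a b
  have hE : 0 ≤ C * Real.exp (-δ * l1 (x - y)) := mul_nonneg hC (Real.exp_nonneg _)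
  rcases a with κ | μ <;> rcases b with l | l
  · simpa [blockMF] using hE
  · simpa [blockMF] using hE
  · simp only [blockMF]
    rw [unitResolvent_inr_inl_eq_neg, abs_neg, l1_sub_comm x y]
    simpa [blockFM] using h y x (Sum.inl l) (Sum.inr μ)
  · simpa [blockMF] using hE

/-- **ONE-STEP DIFFERENCES OF THE `MF` BLOCK FROM THOSE OF THE `FM` BLOCK** (same constants). [folklore] -/
theorem decays_blockMF_sub_of_blockFM {j j' : ℕ} {C δ : ℝ}
    (h : Decays (blockFM (unitResolvent Lc j) - blockFM (unitResolvent Lc j')) C δ) :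
    Decays (blockMF (unitResolvent Lc j) - blockMF (unitResolvent Lc j')) C δ := by
  have hC : 0 ≤ C := h.nonneg (Sum.inl 0)
  intro x y a b
  have hE : 0 ≤ C * Real.exp (-δ * l1 (x - y)) := mul_nonneg hC (Real.exp_nonneg _)
  rcases a with κ | μ <;> rcases b with l | l
  · simpa [blockMF] using hE
  · simpa [blockMF] using hE
  · simp only [Pi.sub_apply, blockMF]
    have e : -unitResolvent Lc j y x (Sum.inl l) (Sum.inr μ) - -unitResolvent Lc j' y x (Sum.inl l) (Sum.inr μ)
        = -(unitResolvent Lc j y x (Sum.inl l) (Sum.inr μ) - unitResolvent Lc j' y x (Sum.inl l) (Sum.inr μ)) := by ring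
    rw [unitResolvent_inr_inl_eq_neg j, unitResolvent_inr_inl_eq_neg j', e, abs_neg, l1_sub_comm x y]
    simpa [blockFM] using h y x (Sum.inl l) (Sum.inr μ)
  · simpa [blockMF] using hE

end Mixed

/-! ## §3 The residual from the two working blocks `FF`, `FM` -/

section Residual

/-- `blockF` of a difference, split into the three block differences. [folklore] -/
theorem blockF_sub_eq {d : ℕ} (K K' : MKer (d + 1) (Fib d)) :
    blockF K - blockF K' = (blockFF K - blockFF K') + (blockFM K - blockFM K') + (blockMF K - blockMF K') := by
  rw [← blockF_sub, blockF, blockFF_sub, blockFM_sub, blockMF_sub]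

/-- **`FieldBlocksRate` FROM THE `FF` AND `FM` ROWS ALONE** (the `MF` rows are supplied by §2; constants `C₁ + 2C₂`, `c₁ + 2c₂`). [folklore] -/
theorem fieldBlocksRate_of_FF_FM {C₁ C₂ δK c₁ c₂ θ : ℝ}
    (hFF : ∀ j, Decays (blockFF (unitResolvent Lc j)) C₁ δK) (hFM : ∀ j, Decays (blockFM (unitResolvent Lc j)) C₂ δK)
    (hFF' : ∀ k j, Decays (blockFF (unitResolvent Lc (k + j)) - blockFF (unitResolvent Lc k)) (c₁ * θ ^ k) δK)
    (hFM' : ∀ k j, Decays (blockFM (unitResolvent Lc (k + j)) - blockFM (unitResolvent Lc k)) (c₂ * θ ^ k) δK) :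
    FieldBlocksRate Lc (C₁ + C₂ + C₂) δK (c₁ + c₂ + c₂) θ := by
  refine ⟨fun j => ?_, fun k j => ?_⟩
  · exact decays_add (decays_add (hFF j) (hFM j)) (decays_blockMF_of_blockFM (hFM j))
  · have h := decays_add (decays_add (hFF' k j) (hFM' k j)) (decays_blockMF_sub_of_blockFM (hFM' k j))
    rw [← blockF_sub_eq] at h
    have e : c₁ * θ ^ k + c₂ * θ ^ k + c₂ * θ ^ k = (c₁ + c₂ + c₂) * θ ^ k := by ring
    rwa [e] at h

end Residual

/-! ## §4 Assembly: the resolvent target from the ONE residual -/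

section Assembly

/-- **(CONV-C), RESOLVENT THIRD, FROM THE FIELD-BLOCK RESIDUAL ALONE** (`Lc ≥ 2`, `Lc⁻² ≤ θ`, `δK ≤ kappaZ 3/(4Lc)`):
`FieldBlocksRate Lc C δK cK θ ⟹ ConvCResolvent Lc (C + |2Lc⁻⁸|·c166Z 3) δK (cK + cMM Lc (2Lc⁻⁸)) θ` — `GAN24/WoodburyFibre`'s assembly with
the dictionary binder discharged by §1. [folklore] -/
theorem convCResolvent_of_fieldBlocksRate (hLc : 2 ≤ Lc) {C δK cK θ : ℝ} (hF : FieldBlocksRate Lc C δK cK θ)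
    (hθ : ((Lc : ℝ) ^ 2)⁻¹ ≤ θ) (hδ : δK ≤ kappaZ 3 / (4 * Lc)) :
    ConvCResolvent Lc (C + |2 * ((Lc : ℝ) ^ 8)⁻¹| * c166Z 3) δK (cK + cMM Lc (2 * ((Lc : ℝ) ^ 8)⁻¹)) θ :=
  convCResolvent_of_multDict_of_fieldBlocksRate hLc (multDict_holds Lc) hF hθ hδ

/-- **(CONV-C), RESOLVENT THIRD, FROM THE `FF` AND `FM` ROWS** (same windows). [folklore] -/
theorem convCResolvent_of_FF_FM (hLc : 2 ≤ Lc) {C₁ C₂ δK c₁ c₂ θ : ℝ}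
    (hFF : ∀ j, Decays (blockFF (unitResolvent Lc j)) C₁ δK) (hFM : ∀ j, Decays (blockFM (unitResolvent Lc j)) C₂ δK)
    (hFF' : ∀ k j, Decays (blockFF (unitResolvent Lc (k + j)) - blockFF (unitResolvent Lc k)) (c₁ * θ ^ k) δK)
    (hFM' : ∀ k j, Decays (blockFM (unitResolvent Lc (k + j)) - blockFM (unitResolvent Lc k)) (c₂ * θ ^ k) δK)
    (hθ : ((Lc : ℝ) ^ 2)⁻¹ ≤ θ) (hδ : δK ≤ kappaZ 3 / (4 * Lc)) :
    ConvCResolvent Lc (C₁ + C₂ + C₂ + |2 * ((Lc : ℝ) ^ 8)⁻¹| * c166Z 3) δK (c₁ + c₂ + c₂ + cMM Lc (2 * ((Lc : ℝ) ^ 8)⁻¹)) θ :=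
  convCResolvent_of_fieldBlocksRate hLc (fieldBlocksRate_of_FF_FM hFF hFM hFF' hFM') hθ hδ

end Assembly

/-! ## §5 The converse, and the K-slot as EXACTLY the field-block residual -/

section Converse

/-- The field blocks of a kernel are, entrywise, the kernel or zero. [folklore] -/
theorem abs_blockF_le {d : ℕ} (K : MKer (d + 1) (Fib d)) (x y : Fin (d + 1) → ℤ) (a b : Fib d) :
    |blockF K x y a b| ≤ |K x y a b| := by
  rcases a with κ | κ <;> rcases b with l | l <;> simp [blockF, blockFF, blockFM, blockMF]

/-- `Decays K ⟹ Decays (blockF K)` (same constants). [folklore] -/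
theorem decays_blockF {d : ℕ} {K : MKer (d + 1) (Fib d)} {C δ : ℝ} (h : Decays K C δ) : Decays (blockF K) C δ :=
  fun x y a b => (abs_blockF_le K x y a b).trans (h x y a b)

/-- **THE CONVERSE**: the resolvent target implies the field-block residual with the same constants. [folklore] -/
theorem fieldBlocksRate_of_convCResolvent {C δK cK θ : ℝ} (h : ConvCResolvent Lc C δK cK θ) : FieldBlocksRate Lc C δK cK θ := by
  refine ⟨fun j => decays_blockF (h.1 j), fun k j => ?_⟩
  rw [← blockF_sub]
  exact decays_blockF (h.2 k j)

/-- Monotonicity of the residual in its windows: smaller decay rate, larger geometric rate. [folklore] -/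
theorem fieldBlocksRate_mono {C δK δK' cK θ θ' : ℝ} (h : FieldBlocksRate Lc C δK cK θ) (hδ : δK' ≤ δK) (hθ0 : 0 ≤ θ)
    (hθ : θ ≤ θ') : FieldBlocksRate Lc C δK' cK θ' := by
  have hC : 0 ≤ C := (h.1 0).nonneg (Sum.inl 0)
  have hcK : 0 ≤ cK := by simpa using (h.2 0 0).nonneg (Sum.inl 0)
  refine ⟨fun j => OneStepResolventKernel.decays_mono (h.1 j) hC le_rfl hδ, fun k j => ?_⟩
  exact OneStepResolventKernel.decays_mono (h.2 k j) (mul_nonneg hcK (pow_nonneg hθ0 k))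
    (mul_le_mul_of_nonneg_left (pow_le_pow_left₀ hθ0 hθ k) hcK) hδ

/-- **THE K-SLOT IS EXACTLY THE FIELD-BLOCK RESIDUAL** (`Lc ≥ 2`): gan24-p1's wall package `ConvCKWall 3 Lc` (the binders `hK`, `hKall`
of the wall's END, existentially packaged; ≡ `ConvCK 3 Lc`, TRIGGER-P1's root by type) holds IFF `FieldBlocksRate` holds for SOME
constants with `0 < δK`, `0 ≤ θ < 1`.  (⇒): blocks of decaying kernels decay.  (⇐): shrink `δK` below `kappaZ 3/(4Lc)`, raise `θ` above
`Lc⁻²`, add the unconditional multiplier block (§1, §4).  The multiplier legs of the K-slot are FREE. [folklore] -/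
theorem convCKWall_iff_exists_fieldBlocksRate (hLc : 2 ≤ Lc) :
    ConvCKWall 3 Lc ↔ ∃ C δK cK θ : ℝ, 0 < δK ∧ 0 ≤ θ ∧ θ < 1 ∧ FieldBlocksRate Lc C δK cK θ := by
  constructor
  · rintro ⟨C, δ, cK, θ, hδ, hθ0, hθ1, hK, hKall⟩
    exact ⟨C, δ, cK, θ, hδ, hθ0, hθ1, fieldBlocksRate_of_convCResolvent (convCResolvent_iff.2 ⟨hK, hKall⟩)⟩
  · rintro ⟨C, δK, cK, θ, hδ, hθ0, hθ1, hF⟩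
    obtain ⟨hθL0, hθL1⟩ := theta_lt_one (Lc := Lc) hLc
    have hL : (0 : ℝ) < Lc := by exact_mod_cast lt_of_lt_of_le (by norm_num) hLc
    set δ' := min δK (kappaZ 3 / (4 * Lc)) with hδ'
    set θ' := max θ (((Lc : ℝ) ^ 2)⁻¹) with hθ'
    have hδ'pos : 0 < δ' := lt_min hδ (div_pos (kappaZ_pos 3) (by positivity))
    have hθ'0 : 0 ≤ θ' := hθ0.trans (le_max_left _ _)
    have hθ'1 : θ' < 1 := max_lt hθ1 hθL1
    have hF' : FieldBlocksRate Lc C δ' cK θ' := fieldBlocksRate_mono hF (min_le_left _ _) hθ0 (le_max_left _ _)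
    exact convCKWall_of_convCResolvent (convCResolvent_of_fieldBlocksRate hLc hF' (le_max_right _ _) (min_le_right _ _))
      hδ'pos hθ'0 hθ'1

/-- **ROAD P1 CLOSES P3's RESIDUAL BY NAME**: `ConvCK 3 Lc ⟹ ∃ …, FieldBlocksRate …`. [folklore] -/
theorem exists_fieldBlocksRate_of_convCK (hLc : 2 ≤ Lc) (h : ConvCK 3 Lc) :
    ∃ C δK cK θ : ℝ, 0 < δK ∧ 0 ≤ θ ∧ θ < 1 ∧ FieldBlocksRate Lc C δK cK θ :=
  (convCKWall_iff_exists_fieldBlocksRate hLc).1 (CombesThomas.convCKWall_of_convCK h)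

/-- **THE K-SLOT FROM THE TWO WORKING BLOCKS**: `FF` and `FM` rows with `0 < δK`, `0 ≤ θ < 1` give `ConvCKWall 3 Lc` (`Lc ≥ 2`). [folklore] -/
theorem convCKWall_of_FF_FM (hLc : 2 ≤ Lc) {C₁ C₂ δK c₁ c₂ θ : ℝ} (hδ : 0 < δK) (hθ0 : 0 ≤ θ) (hθ1 : θ < 1)
    (hFF : ∀ j, Decays (blockFF (unitResolvent Lc j)) C₁ δK) (hFM : ∀ j, Decays (blockFM (unitResolvent Lc j)) C₂ δK)
    (hFF' : ∀ k j, Decays (blockFF (unitResolvent Lc (k + j)) - blockFF (unitResolvent Lc k)) (c₁ * θ ^ k) δK)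
    (hFM' : ∀ k j, Decays (blockFM (unitResolvent Lc (k + j)) - blockFM (unitResolvent Lc k)) (c₂ * θ ^ k) δK) :
    ConvCKWall 3 Lc :=
  (convCKWall_iff_exists_fieldBlocksRate hLc).2 ⟨_, _, _, _, hδ, hθ0, hθ1, fieldBlocksRate_of_FF_FM hFF hFM hFF' hFM'⟩

end Converse

/-! ## §6 (v1.1, append-only) The STENCIL-SIDE twin: an2's value 2-jet `E2 d L j` IS `2·(L^j)^{−(d+5)}·Δ_j` — every `d`, `L`, `j`;
its unit-normalised family decays `j`-uniformly and is Cauchy at rate `L⁻²` (Bałaban's (1.66) constants BY NAME)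

The wall's STENCIL binders `hS`/`hSall` read Bałaban's step jets `Sstep … j`, whose Lagrange part carries `E2 d Lc j = mmRead (Lc^j) (KInv (Lc^j))`
(`BalabanStepJetsSucc`); by an4's `SecondOrderUnits.E2_succ_apply` the `(inl,inl)` entries of `E2 (j+1)` ARE the multiplier block of `KInvStep Lc j`
at the `Lc`-dilated points — the object of §1.  Here the same dictionary is recorded for `E2` itself, in every dimension: the `Δ_k`-constituent of
(CONV-C) on the stencil side, with NO hypothesis.  (Which power of `L^j` the wall's `unitS` finally attaches to `E2` is the suppliers' units
bookkeeping — an2 (P4) ∕ an4 (R1), GAPS Q-asym1-8 — and is not asserted here: the rows below are stated for the canonical normalisation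
`((L^j)^{d+5}/2)·E2 d L j`, whose entries are LITERALLY `deltaZ L j`.) -/

section Stencil

open BalabanStepJetsSucc (E2 mmRead_inl_inl mmRead_inr_left mmRead_inr_right)
open OneStepResolventKernel (KInv_inr_inr_coarse)
open Summit.QuantumFields.BalabanUV.Beta.GAN24.DirichletExhaustionDeltaZ (deltaZ)
open Summit.QuantumFields.BalabanUV.Beta.GAN24.MultiplierDictionary (wΦ_eq_deltaZ)
open Summit.QuantumFields.BalabanUV.Beta.GAN24.TransverseDictionary (deltaZ_abs_le_l1 deltaZ_step_abs_le_l1)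
open B4Sect5Exhaustion (K)

variable {d : ℕ} (L : ℕ) [NeZero L]

/-- **`E2 = 2·(L^j)^{−(d+5)}·Δ_j` ENTRYWISE**: the field–field slot of an2's value 2-jet of the `j`-fold composite system is leaf-18's
dictionary `wΦ_eq_deltaZ` read through `mmRead`/`KInv_inr_inr_coarse` (every `d`, `L ≥ 1`, `j`). [folklore] -/
theorem E2_inl_inl_eq_deltaZ (j : ℕ) (x' z' : Fin (d + 1) → ℤ) (α β : Fin (d + 1)) :
    E2 d L j x' z' (Sum.inl α) (Sum.inl β) = (2 * ((((L : ℕ) : ℝ) ^ j) ^ (d + 5))⁻¹) * deltaZ L j (x' - z', α) (0, β) := by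
  rw [E2, mmRead_inl_inl, KInv_inr_inr_coarse, wΦ_eq_deltaZ]

/-- The other three slots of `E2` vanish (it is an `mmRead`). [folklore] -/
theorem E2_apply_eq_zero_of_not_inl_inl (j : ℕ) (x' z' : Fin (d + 1) → ℤ) (a b : Fib d)
    (h : ¬ ∃ α β : Fin (d + 1), a = Sum.inl α ∧ b = Sum.inl β) : E2 d L j x' z' a b = 0 := by
  rcases a with α | μ <;> rcases b with β | ν
  · exact absurd ⟨α, β, rfl, rfl⟩ h
  · exact mmRead_inr_right _ _ _ _ _ _
  · exact mmRead_inr_left _ _ _ _ _ _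
  · exact mmRead_inr_left _ _ _ _ _ _

/-- **THE UNIT-NORMALISED VALUE 2-JET IS `Δ_j` ON THE NOSE**: `((L^j)^{d+5}/2)·E2 d L j (x′,z′)_{inl α, inl β} = deltaZ L j ((x′−z′,α),(0,β))`. [folklore] -/
theorem E2_unit_inl_inl (j : ℕ) (x' z' : Fin (d + 1) → ℤ) (α β : Fin (d + 1)) :
    (((((L : ℕ) : ℝ) ^ j) ^ (d + 5) / 2) • E2 d L j) x' z' (Sum.inl α) (Sum.inl β) = deltaZ L j (x' - z', α) (0, β) := by
  have hL : (((L : ℕ) : ℝ) ^ j) ^ (d + 5) ≠ 0 := pow_ne_zero _ (pow_ne_zero _ (Nat.cast_ne_zero.2 (NeZero.ne L)))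
  simp only [Pi.smul_apply, smul_eq_mul, E2_inl_inl_eq_deltaZ]
  field_simp

/-- **(CONV-C) FOR THE `Δ_k`-CONSTITUENT ON THE STENCIL SIDE, UNIFORM ROW**: the unit-normalised value 2-jets decay `j`-UNIFORMLY,
`|((L^j)^{d+5}/2)·E2 d L j (x′,z′)| ≤ c166Z(d)·e^{−kappaZ(d)|x′−z′|₁}` (p2's `deltaZ_abs_le` in leaf-18's `ℓ¹` form, BY NAME). [folklore] -/
theorem decays_E2_unit (j : ℕ) : Decays (((((L : ℕ) : ℝ) ^ j) ^ (d + 5) / 2) • E2 d L j) (c166Z d) (kappaZ d) := by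
  intro x' z' a b
  have hE : 0 ≤ c166Z d * Real.exp (-(kappaZ d) * l1 (x' - z')) := by
    have h0 := deltaZ_abs_le_l1 (d := d) L j (x' - z', (0 : Fin (d + 1))) (0, (0 : Fin (d + 1)))
    exact (abs_nonneg _).trans (by simpa [sub_zero] using h0)
  by_cases h : ∃ α β : Fin (d + 1), a = Sum.inl α ∧ b = Sum.inl β
  · obtain ⟨α, β, rfl, rfl⟩ := h
    rw [E2_unit_inl_inl]
    simpa [sub_zero] using deltaZ_abs_le_l1 (d := d) L j (x' - z', α) (0, β)
  · have h0 : (((((L : ℕ) : ℝ) ^ j) ^ (d + 5) / 2) • E2 d L j) x' z' a b = 0 := by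
      simp only [Pi.smul_apply, smul_eq_mul, E2_apply_eq_zero_of_not_inl_inl L j x' z' a b h, mul_zero]
    rw [h0, abs_zero, neg_mul]
    simpa [neg_mul] using hE

/-- **(CONV-C) FOR THE `Δ_k`-CONSTITUENT ON THE STENCIL SIDE, ONE-STEP ROW**: `|((L^{j+1})^{d+5}/2)·E2 (j+1) − ((L^j)^{d+5}/2)·E2 j|(x′,z′)
≤ theta166Z(d)·(L⁻²)^j·e^{−kappaZ(d)|x′−z′|₁}` (p2's `deltaZ_step_abs_le` in `ℓ¹` form, BY NAME). [folklore] -/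
theorem decays_E2_unit_step (j : ℕ) :
    Decays (((((L : ℕ) : ℝ) ^ (j + 1)) ^ (d + 5) / 2) • E2 d L (j + 1) - ((((L : ℕ) : ℝ) ^ j) ^ (d + 5) / 2) • E2 d L j)
      (theta166Z d * (((L : ℝ) ^ 2)⁻¹) ^ j) (kappaZ d) := by
  intro x' z' a b
  have hE : 0 ≤ theta166Z d * (((L : ℝ) ^ 2)⁻¹) ^ j * Real.exp (-(kappaZ d) * l1 (x' - z')) := by
    have h0 := deltaZ_step_abs_le_l1 (d := d) L j (x' - z', (0 : Fin (d + 1))) (0, (0 : Fin (d + 1)))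
    exact (abs_nonneg _).trans (by simpa [sub_zero] using h0)
  by_cases h : ∃ α β : Fin (d + 1), a = Sum.inl α ∧ b = Sum.inl β
  · obtain ⟨α, β, rfl, rfl⟩ := h
    rw [Pi.sub_apply, Pi.sub_apply, Pi.sub_apply, Pi.sub_apply, E2_unit_inl_inl, E2_unit_inl_inl]
    simpa [sub_zero] using deltaZ_step_abs_le_l1 (d := d) L j (x' - z', α) (0, β)
  · have h1 : (((((L : ℕ) : ℝ) ^ (j + 1)) ^ (d + 5) / 2) • E2 d L (j + 1)) x' z' a b = 0 := by
      simp only [Pi.smul_apply, smul_eq_mul, E2_apply_eq_zero_of_not_inl_inl L (j + 1) x' z' a b h, mul_zero]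
    have h0 : (((((L : ℕ) : ℝ) ^ j) ^ (d + 5) / 2) • E2 d L j) x' z' a b = 0 := by
      simp only [Pi.smul_apply, smul_eq_mul, E2_apply_eq_zero_of_not_inl_inl L j x' z' a b h, mul_zero]
    rw [Pi.sub_apply, Pi.sub_apply, Pi.sub_apply, Pi.sub_apply, h1, h0, sub_zero, abs_zero]
    exact hE

/-- **ALL-SCALES ROW** (`L ≥ 2`): `|((L^{k+j})^{d+5}/2)·E2 (k+j) − ((L^k)^{d+5}/2)·E2 k|(x′,z′) ≤ (theta166Z d·θ^k/(1−θ))·e^{−kappaZ(d)|x′−z′|₁}`,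
`θ = L⁻²` — the one-step row summed geometrically (`WoodburyFibre.abs_sub_le_of_step_le`). [folklore] -/
theorem decays_E2_unit_sub (hL : 2 ≤ L) (k j : ℕ) :
    Decays (((((L : ℕ) : ℝ) ^ (k + j)) ^ (d + 5) / 2) • E2 d L (k + j) - ((((L : ℕ) : ℝ) ^ k) ^ (d + 5) / 2) • E2 d L k)
      (theta166Z d * (((L : ℝ) ^ 2)⁻¹) ^ k / (1 - ((L : ℝ) ^ 2)⁻¹)) (kappaZ d) := by
  obtain ⟨hθ0, hθ1⟩ := theta_lt_one (Lc := L) hL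
  set θ := ((L : ℝ) ^ 2)⁻¹ with hθ
  intro x' z' a b
  set f : ℕ → ℝ := fun i => (((((L : ℕ) : ℝ) ^ i) ^ (d + 5) / 2) • E2 d L i) x' z' a b with hf
  have hstep : ∀ i, |f (i + 1) - f i| ≤ theta166Z d * Real.exp (-(kappaZ d) * l1 (x' - z')) * θ ^ i := by
    intro i
    have h := decays_E2_unit_step (d := d) L i x' z' a b
    rw [Pi.sub_apply, Pi.sub_apply, Pi.sub_apply, Pi.sub_apply] at h
    calc |f (i + 1) - f i| ≤ theta166Z d * θ ^ i * Real.exp (-(kappaZ d) * l1 (x' - z')) := h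
      _ = theta166Z d * Real.exp (-(kappaZ d) * l1 (x' - z')) * θ ^ i := by ring
  have hθd : 0 ≤ theta166Z d := by
    have h := deltaZ_step_abs_le_l1 (d := d) L 0 ((0, 0) : K (d + 1) (d + 1)) ((0, 0) : K (d + 1) (d + 1))
    have e : Real.exp (-(kappaZ d) * l1 (((0, 0) : K (d + 1) (d + 1)).1 - ((0, 0) : K (d + 1) (d + 1)).1)) = 1 := by
      simp [l1]
    rw [e, pow_zero, mul_one, mul_one] at h
    exact (abs_nonneg _).trans h
  have ha : 0 ≤ theta166Z d * Real.exp (-(kappaZ d) * l1 (x' - z')) := mul_nonneg hθd (Real.exp_nonneg _)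
  have htel := abs_sub_le_of_step_le (f := f) ha hθ0 hθ1 hstep k j
  rw [Pi.sub_apply, Pi.sub_apply, Pi.sub_apply, Pi.sub_apply]
  calc |f (k + j) - f k| ≤ theta166Z d * Real.exp (-(kappaZ d) * l1 (x' - z')) * θ ^ k / (1 - θ) := htel
    _ = theta166Z d * θ ^ k / (1 - θ) * Real.exp (-(kappaZ d) * l1 (x' - z')) := by ring

end Stencil

end Summit.QuantumFields.BalabanUV.Beta.GAN24.WoodburyFibreAssembly

end
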